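import Summits.RiemannHypothesis.RiemannHypothesis.Theorems.Splittings.SplitXWucK1RI
import HarnessLib

/-!
# Splittings — x-wuc GEN-11 `SplitXWucK1R` (K1′(ℝ) AT THE STAKE) — mechanical carve part 10/14
Continuation of `Summits.RiemannHypothesis.RiemannHypothesis.Theorems.Splittings.SplitXWucK1RI`: byte-identical declaration units of the referee-passed extract `SplitXWucK1R.lean`
sha16 70c8eb2af2868881 (x-wuc g11; ref g10 PASS 2026-08-27T22:59:46Z; RULING #330); open namespaces/sections re-opened with their context.
HONEST LABEL: splitting search over kernel-typed RH-equivalences; K-CERT′ (complex `f`) stays OPEN; nothing here bears on the truth of RH.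
-/
set_option linter.dupNamespace false
noncomputable section
open scoped Classical ComplexConjugate
open Set Filter Topology Complex MeasureTheory
open Real Set Filter Topology
open Real Set MeasureTheory Complex Filter Topology
open scoped Real
namespace Summit.RiemannHypothesis.RiemannHypothesis.Theorems.Splittings.XWucG8
/-- **generic window tail bound (mass σ, scale L).** If `0 ≤ c n ≤ 1/(s − πn)²` and `Σ c = 1` then the mass outside the window
`⌈(s−R)/π⌉ ≤ n ≤ ⌊(s+R)/π⌋` is at most `2/(πR) + 2/R²` (`π ≤ R`). -/
theorem sub_window_sum_le (s R L σ : ℝ) (hR : π ≤ R) (hL : 0 ≤ L) (c : ℤ → ℝ) (hc0 : ∀ n, 0 ≤ c n)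
    (hcs : HasSum c σ) (hcle : ∀ n : ℤ, c n ≤ L / (s - π * n) ^ 2) :
    σ - ∑ n ∈ Finset.Icc ⌈(s - R) / π⌉ ⌊(s + R) / π⌋, c n ≤ L * (2 / (π * R) + 2 / R ^ 2) := by
  have hπ := Real.pi_pos
  have hR0 : 0 < R := lt_of_lt_of_le hπ hR
  set A : ℤ := ⌈(s - R) / π⌉ with hA
  set B : ℤ := ⌊(s + R) / π⌋ with hB
  have hBlt : s + R < π * B + π := by
    have h := Int.lt_floor_add_one ((s + R) / π)
    rw [← hB] at h
    rw [div_lt_iff₀ hπ] at h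
    linarith [h]
  have hAlt : π * A - π < s - R := by
    have h := Int.ceil_lt_add_one ((s - R) / π)
    rw [← hA] at h
    have h' : (A : ℝ) - 1 < (s - R) / π := by linarith
    rw [lt_div_iff₀ hπ] at h'
    linarith [h']
  have hAB : A ≤ B + 1 := by
    have h1 : (A : ℝ) < (s - R) / π + 1 := by
      have := Int.ceil_lt_add_one ((s - R) / π); rwa [← hA] at this
    have h2 : (s + R) / π < B + 1 := by
      have := Int.lt_floor_add_one ((s + R) / π); rwa [← hB] at this
    have h3 : (s - R) / π + 1 ≤ (s + R) / π := by
      rw [div_add_one hπ.ne', div_le_div_iff_of_pos_right hπ]; linarith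
    have : (A : ℝ) < B + 1 := by linarith
    exact_mod_cast this.le
  -- one-sided bounds
  have hright : ∀ n : ℤ, B < n → c n ≤ L / (R + π * (((n - B - 1 : ℤ)) : ℝ)) ^ 2 := by
    intro n hn
    have hk0 : (0 : ℝ) ≤ ((n - B - 1 : ℤ) : ℝ) := by exact_mod_cast (by omega : (0 : ℤ) ≤ n - B - 1)
    have h1 : R + π * (((n - B - 1 : ℤ)) : ℝ) ≤ π * n - s := by push_cast; nlinarith
    have h2 : 0 < R + π * (((n - B - 1 : ℤ)) : ℝ) := by positivity
    calc c n ≤ L / (s - π * n) ^ 2 := hcle n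
      _ = L / (π * n - s) ^ 2 := by rw [show (s - π * n) ^ 2 = (π * n - s) ^ 2 by ring]
      _ ≤ L / (R + π * (((n - B - 1 : ℤ)) : ℝ)) ^ 2 :=
          div_le_div_of_nonneg_left hL (pow_pos h2 2) (pow_le_pow_left₀ h2.le h1 2)
  have hleft : ∀ n : ℤ, n < A → c n ≤ L / (R + π * (((A - 1 - n : ℤ)) : ℝ)) ^ 2 := by
    intro n hn
    have hk0 : (0 : ℝ) ≤ ((A - 1 - n : ℤ) : ℝ) := by exact_mod_cast (by omega : (0 : ℤ) ≤ A - 1 - n)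
    have h1 : R + π * (((A - 1 - n : ℤ)) : ℝ) ≤ s - π * n := by push_cast; nlinarith
    have h2 : 0 < R + π * (((A - 1 - n : ℤ)) : ℝ) := by positivity
    calc c n ≤ L / (s - π * n) ^ 2 := hcle n
      _ ≤ L / (R + π * (((A - 1 - n : ℤ)) : ℝ)) ^ 2 :=
          div_le_div_of_nonneg_left hL (pow_pos h2 2) (pow_le_pow_left₀ h2.le h1 2)
  -- finite partial sums are bounded
  have key : ∀ F : Finset ℤ, ∑ n ∈ F, c n ≤ (∑ n ∈ Finset.Icc A B, c n) + L * (2 / (π * R) + 2 / R ^ 2) := by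
    intro F
    obtain ⟨N, hN⟩ := F.bddAbove
    obtain ⟨Lo, hLo⟩ := F.bddBelow
    rw [← Finset.sum_filter_add_sum_filter_not F (fun n => n ∈ Finset.Icc A B)]
    have h1 : ∑ n ∈ F.filter (fun n => n ∈ Finset.Icc A B), c n ≤ ∑ n ∈ Finset.Icc A B, c n := by
      apply Finset.sum_le_sum_of_subset_of_nonneg
      · intro n hn; exact (Finset.mem_filter.mp hn).2
      · intro n _ _; exact hc0 n
    -- right tail
    have hr : ∑ n ∈ F.filter (fun n => B < n), c n ≤ L * (1 / R ^ 2 + 1 / (π * R)) := by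
      set K : ℕ := (N - B).toNat with hK
      let emb : ℕ ↪ ℤ := ⟨fun k => B + 1 + (k : ℤ), fun a b h => by simpa using h⟩
      have hsub : F.filter (fun n => B < n) ⊆ (Finset.range K).map emb := by
        intro n hn
        rw [Finset.mem_filter] at hn
        have hnN : n ≤ N := hN hn.1
        rw [Finset.mem_map]
        refine ⟨(n - B - 1).toNat, ?_, ?_⟩
        · rw [Finset.mem_range]; omega
        · simp only [emb, Function.Embedding.coeFn_mk]; omega
      calc ∑ n ∈ F.filter (fun n => B < n), c n
          ≤ ∑ n ∈ F.filter (fun n => B < n), L / (R + π * (((n - B - 1 : ℤ)) : ℝ)) ^ 2 :=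
            Finset.sum_le_sum (fun n hn => hright n (Finset.mem_filter.mp hn).2)
        _ ≤ ∑ n ∈ (Finset.range K).map emb, L / (R + π * (((n - B - 1 : ℤ)) : ℝ)) ^ 2 :=
            Finset.sum_le_sum_of_subset_of_nonneg hsub (fun n _ _ => by positivity)
        _ = L * ∑ k ∈ Finset.range K, 1 / (R + π * k) ^ 2 := by
            rw [Finset.sum_map, Finset.mul_sum]
            apply Finset.sum_congr rfl
            intro k _
            simp only [emb, Function.Embedding.coeFn_mk]
            rw [show (B + 1 + (k : ℤ) - B - 1 : ℤ) = k by ring]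
            push_cast
            rw [mul_one_div]
        _ ≤ L * (1 / R ^ 2 + 1 / (π * R)) := mul_le_mul_of_nonneg_left (DSLine.sum_inv_sq_shift_le hR0 K) hL
    -- left tail
    have hl : ∑ n ∈ F.filter (fun n => n < A), c n ≤ L * (1 / R ^ 2 + 1 / (π * R)) := by
      set K : ℕ := (A - Lo).toNat with hK
      let emb : ℕ ↪ ℤ := ⟨fun k => A - 1 - (k : ℤ), fun a b h => by simpa using h⟩
      have hsub : F.filter (fun n => n < A) ⊆ (Finset.range K).map emb := by
        intro n hn
        rw [Finset.mem_filter] at hn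
        have hnL : Lo ≤ n := hLo hn.1
        rw [Finset.mem_map]
        refine ⟨(A - 1 - n).toNat, ?_, ?_⟩
        · rw [Finset.mem_range]; omega
        · simp only [emb, Function.Embedding.coeFn_mk]; omega
      calc ∑ n ∈ F.filter (fun n => n < A), c n
          ≤ ∑ n ∈ F.filter (fun n => n < A), L / (R + π * (((A - 1 - n : ℤ)) : ℝ)) ^ 2 :=
            Finset.sum_le_sum (fun n hn => hleft n (Finset.mem_filter.mp hn).2)
        _ ≤ ∑ n ∈ (Finset.range K).map emb, L / (R + π * (((A - 1 - n : ℤ)) : ℝ)) ^ 2 :=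
            Finset.sum_le_sum_of_subset_of_nonneg hsub (fun n _ _ => by positivity)
        _ = L * ∑ k ∈ Finset.range K, 1 / (R + π * k) ^ 2 := by
            rw [Finset.sum_map, Finset.mul_sum]
            apply Finset.sum_congr rfl
            intro k _
            simp only [emb, Function.Embedding.coeFn_mk]
            rw [show (A - 1 - (A - 1 - (k : ℤ)) : ℤ) = k by ring]
            push_cast
            rw [mul_one_div]
        _ ≤ L * (1 / R ^ 2 + 1 / (π * R)) := mul_le_mul_of_nonneg_left (DSLine.sum_inv_sq_shift_le hR0 K) hL
    have hsub2 : F.filter (fun n => ¬ n ∈ Finset.Icc A B) ⊆ F.filter (fun n => B < n) ∪ F.filter (fun n => n < A) := by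
      intro n hn
      rw [Finset.mem_filter, Finset.mem_Icc, not_and_or, not_le, not_le] at hn
      rw [Finset.mem_union, Finset.mem_filter, Finset.mem_filter]
      rcases hn.2 with h | h
      · exact Or.inr ⟨hn.1, h⟩
      · exact Or.inl ⟨hn.1, h⟩
    have hdisj : Disjoint (F.filter (fun n => B < n)) (F.filter (fun n => n < A)) := by
      rw [Finset.disjoint_filter]; intro n _ h1 h2; omega
    have h2 : ∑ n ∈ F.filter (fun n => ¬ n ∈ Finset.Icc A B), c n ≤ L * (2 / (π * R) + 2 / R ^ 2) := by
      calc ∑ n ∈ F.filter (fun n => ¬ n ∈ Finset.Icc A B), c n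
          ≤ ∑ n ∈ F.filter (fun n => B < n) ∪ F.filter (fun n => n < A), c n :=
            Finset.sum_le_sum_of_subset_of_nonneg hsub2 (fun n _ _ => hc0 n)
        _ = ∑ n ∈ F.filter (fun n => B < n), c n + ∑ n ∈ F.filter (fun n => n < A), c n :=
            Finset.sum_union hdisj
        _ ≤ L * (1 / R ^ 2 + 1 / (π * R)) + L * (1 / R ^ 2 + 1 / (π * R)) := add_le_add hr hl
        _ = L * (2 / (π * R) + 2 / R ^ 2) := by ring
    linarith
  have ht : σ ≤ (∑ n ∈ Finset.Icc A B, c n) + L * (2 / (π * R) + 2 / R ^ 2) := le_of_tendsto' hcs key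
  linarith

namespace CoshKernel
/-- the cosh-kernel coefficient mass off the centre: `Σ_{n ≠ 0} ‖cc κ n‖ = cosh κ − sinh κ/κ`. -/
theorem hasSum_norm_cc_ne_zero (κ : ℝ) (hκ : 0 < κ) :
    HasSum (fun n : ℤ => if n = 0 then (0 : ℝ) else ‖(cc κ n : ℂ)‖) (Real.cosh κ - Real.sinh κ / κ) := by
  haveI : Fact ((0 : ℝ) < 2) := ⟨two_pos⟩
  have hc0 : ‖(cc κ 0 : ℂ)‖ = Real.sinh κ / κ := by
    rw [norm_cc κ hκ]; simp; field_simp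
  have h3 := (hasSum_norm_cc κ hκ).sub (hasSum_ite_eq (0 : ℤ) ‖(cc κ 0 : ℂ)‖)
  rw [hc0] at h3
  have e : (fun n : ℤ => if n = 0 then (0 : ℝ) else ‖(cc κ n : ℂ)‖)
      = fun n : ℤ => ‖(cc κ n : ℂ)‖ - if n = 0 then Real.sinh κ / κ else 0 := by
    funext n
    by_cases hn : n = 0
    · subst hn; simp only [if_true, hc0, sub_self]
    · simp only [hn, if_false, sub_zero]
  rw [e]; exact h3

/-- the cosh-kernel TAIL: the coefficient mass outside `|πn| ≤ R` (`R ≥ π`) is `≤ κ sinh κ · (2/(πR) + 2/R²)`. -/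
theorem cc_tail_le (κ : ℝ) (hκ : 0 < κ) {R : ℝ} (hR : π ≤ R) :
    (Real.cosh κ - Real.sinh κ / κ)
      - ∑ n ∈ Finset.Icc ⌈((0 : ℝ) - R) / π⌉ ⌊((0 : ℝ) + R) / π⌋, (if n = 0 then (0 : ℝ) else ‖(cc κ n : ℂ)‖)
      ≤ κ * Real.sinh κ * (2 / (π * R) + 2 / R ^ 2) := by
  haveI : Fact ((0 : ℝ) < 2) := ⟨two_pos⟩
  have hL : 0 ≤ κ * Real.sinh κ := by
    have := Real.sinh_pos_iff.mpr hκ; positivity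
  refine sub_window_sum_le 0 R (κ * Real.sinh κ) _ hR hL _ (fun n => ?_) (hasSum_norm_cc_ne_zero κ hκ) (fun n => ?_)
  · by_cases hn : n = 0
    · simp [hn]
    · simp only [hn, if_false]; exact norm_nonneg _
  · by_cases hn : n = 0
    · subst hn; simp
    · simp only [hn, if_false]
      rw [norm_cc κ hκ]
      have hn' : (n : ℝ) ≠ 0 := by exact_mod_cast hn
      have hpos : 0 < (0 - π * (n : ℝ)) ^ 2 := by
        have : 0 - π * (n : ℝ) ≠ 0 := by
          intro h; apply hn'; have := Real.pi_pos; nlinarith [sq_nonneg (n:ℝ), sq_nonneg π, mul_pos this this]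
        positivity
      apply div_le_div_of_nonneg_left hL hpos
      nlinarith [sq_nonneg κ]

/-- **LOCAL DENT LEMMA.** `‖T(x,κ) − (sinh κ/κ)·T(x,0)‖ ≤ (cosh κ − sinh κ/κ)·Mloc + κ sinh κ (2/(πR) + 2/R²)·(M − Mloc)` whenever
`‖T(z,0)‖ ≤ Mloc` for `|z − x| ≤ R` (`R ≥ π`) and `‖T(·,0)‖ ≤ M ≥ Mloc` everywhere. -/
theorem norm_tfT_sub_le_local (f : ℝ → ℂ) (hf : Continuous f) (κ : ℝ) (hκ : 0 < κ) {M Mloc R : ℝ}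
    (hM : ∀ y : ℝ, ‖tfT f y 0‖ ≤ M) (x : ℝ) (hR : π ≤ R) (hloc : ∀ z : ℝ, |z - x| ≤ R → ‖tfT f z 0‖ ≤ Mloc)
    (hMloc : Mloc ≤ M) :
    ‖tfT f x κ - (Real.sinh κ / κ : ℝ) * tfT f x 0‖
      ≤ (Real.cosh κ - Real.sinh κ / κ) * Mloc + κ * Real.sinh κ * (2 / (π * R) + 2 / R ^ 2) * (M - Mloc) := by
  haveI : Fact ((0 : ℝ) < 2) := ⟨two_pos⟩
  have hπ := Real.pi_pos
  have hR0 : 0 < R := lt_of_lt_of_le hπ hR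
  set W : Finset ℤ := Finset.Icc ⌈((0 : ℝ) - R) / π⌉ ⌊((0 : ℝ) + R) / π⌋ with hW
  have hWmem : ∀ n ∈ W, |π * (n : ℝ)| ≤ R := by
    intro n hn
    rw [hW, Finset.mem_Icc] at hn
    have h1 : ((0 : ℝ) - R) / π ≤ n := Int.ceil_le.mp hn.1
    have h2 : (n : ℝ) ≤ ((0 : ℝ) + R) / π := Int.le_floor.mp hn.2
    rw [div_le_iff₀ hπ] at h1
    rw [le_div_iff₀ hπ] at h2
    rw [abs_le]; constructor <;> linarith [mul_comm (n : ℝ) π]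
  set s : ℤ → ℂ := fun n => (cc κ n : ℂ) * tfT f (x + π * n) 0 with hs_def
  have hs : HasSum s (tfT f x κ) := hasSum_tfT f hf κ hκ x
  have hs0 : s 0 = (Real.sinh κ / κ : ℝ) * tfT f x 0 := by
    simp only [hs_def, Int.cast_zero, mul_zero, add_zero, cc_zero κ hκ]
  have h1 : HasSum (fun n : ℤ => if n = 0 then s 0 else 0) (s 0) := hasSum_ite_eq 0 (s 0)
  have h2 := hs.sub h1
  -- coefficient weights off the centre and the comparison series
  set c : ℤ → ℝ := fun n => if n = 0 then (0 : ℝ) else ‖(cc κ n : ℂ)‖ with hc_def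
  have hc0 : ∀ n, 0 ≤ c n := by
    intro n; by_cases hn : n = 0
    · simp [hc_def, hn]
    · simp only [hc_def, hn, if_false]; exact norm_nonneg _
  have hcs : HasSum c (Real.cosh κ - Real.sinh κ / κ) := hasSum_norm_cc_ne_zero κ hκ
  set g : ℤ → ℝ := fun n => if n ∈ W then c n * Mloc else c n * M with hg_def
  have hle : ∀ n : ℤ, ‖s n - (if n = 0 then s 0 else 0)‖ ≤ g n := by
    intro n
    by_cases hn : n = 0
    · subst hn
      have : (0 : ℤ) ∈ W := by
        rw [hW, Finset.mem_Icc]; constructor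
        · apply Int.ceil_le.mpr; push_cast
          rw [zero_sub, neg_div]; exact neg_nonpos.mpr (div_nonneg hR0.le hπ.le)
        · apply Int.le_floor.mpr; push_cast
          rw [zero_add]; exact div_nonneg hR0.le hπ.le
      simp [hg_def, hc_def, this]
    · simp only [hn, if_false, sub_zero, hs_def, norm_mul]
      by_cases hw : n ∈ W
      · simp only [hg_def, hc_def, if_pos hw, hn, if_false]
        refine mul_le_mul_of_nonneg_left (hloc _ ?_) (norm_nonneg _)
        rw [show x + π * n - x = π * n by ring]; exact hWmem n hw
      · simp only [hg_def, hc_def, if_neg hw, hn, if_false]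
        exact mul_le_mul_of_nonneg_left (hM _) (norm_nonneg _)
  have hgabs : ∀ n : ℤ, ‖g n‖ ≤ c n * (|Mloc| + |M|) := by
    intro n
    by_cases hw : n ∈ W
    · simp only [hg_def, if_pos hw, Real.norm_eq_abs, abs_mul, abs_of_nonneg (hc0 n)]
      nlinarith [hc0 n, abs_nonneg M, le_abs_self Mloc, neg_abs_le Mloc]
    · simp only [hg_def, if_neg hw, Real.norm_eq_abs, abs_mul, abs_of_nonneg (hc0 n)]
      nlinarith [hc0 n, abs_nonneg Mloc, le_abs_self M, neg_abs_le M]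
  have hgsum : Summable g := Summable.of_norm_bounded (hcs.summable.mul_right (|Mloc| + |M|)) hgabs
  have hsumm : Summable (fun n : ℤ => ‖s n - (if n = 0 then s 0 else 0)‖) :=
    Summable.of_nonneg_of_le (fun n => norm_nonneg _) hle hgsum
  -- evaluate Σ g
  have hsplit_g := hgsum.sum_add_tsum_compl (s := W)
  have hsplit_c := hcs.summable.sum_add_tsum_compl (s := W)
  have hgW : ∑ n ∈ W, g n = (∑ n ∈ W, c n) * Mloc := by
    rw [Finset.sum_mul]
    exact Finset.sum_congr rfl (fun n hn => by simp only [hg_def, if_pos hn])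
  have hgC : ∑' n : ↑((W : Set ℤ)ᶜ), g n = (∑' n : ↑((W : Set ℤ)ᶜ), c n) * M := by
    rw [← tsum_mul_right]
    exact tsum_congr (fun n => by
      have hn : (n : ℤ) ∉ W := fun h => n.2 h
      simp only [hg_def, if_neg hn])
  have htot : ∑' n : ℤ, c n = Real.cosh κ - Real.sinh κ / κ := hcs.tsum_eq
  have htail : (Real.cosh κ - Real.sinh κ / κ) - ∑ n ∈ W, c n
      ≤ κ * Real.sinh κ * (2 / (π * R) + 2 / R ^ 2) := cc_tail_le κ hκ hR
  have hval : ∑' n : ℤ, g n = (Real.cosh κ - Real.sinh κ / κ) * Mloc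
      + ((Real.cosh κ - Real.sinh κ / κ) - ∑ n ∈ W, c n) * (M - Mloc) := by
    rw [← hsplit_g, hgW, hgC]
    have : ∑' n : ↑((W : Set ℤ)ᶜ), c n = (Real.cosh κ - Real.sinh κ / κ) - ∑ n ∈ W, c n := by
      rw [← htot, ← hsplit_c]; ring
    rw [this]; ring
  have hMM : 0 ≤ M - Mloc := sub_nonneg.mpr hMloc
  rw [← hs0, ← h2.tsum_eq]
  calc ‖∑' n : ℤ, (s n - if n = 0 then s 0 else 0)‖
      ≤ ∑' n : ℤ, ‖s n - (if n = 0 then s 0 else 0)‖ := norm_tsum_le_tsum_norm hsumm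
    _ ≤ ∑' n : ℤ, g n := Summable.tsum_le_tsum hle hsumm hgsum
    _ = _ := hval
    _ ≤ _ := by nlinarith [htail, hMM]

end CoshKernel
end Summit.RiemannHypothesis.RiemannHypothesis.Theorems.Splittings.XWucG8
open Real Set MeasureTheory Complex Filter Topology
open scoped Real
namespace Summit.RiemannHypothesis.RiemannHypothesis.Theorems.Splittings.XWucG8.DSLine
/-- `tau_le_one_aux` — helper of the x-wuc GEN-11 chain «K1′(ℝ) at the stake» (verbatim from the referee-passed extract `SplitXWucK1R.lean` 70c8eb2af2868881; role: see the module docstring). -/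
theorem tau_le_one_aux {R : ℝ} (hR : π ≤ R) : 2 / (π * R) + 2 / R ^ 2 ≤ 1 := by
  have hπ := Real.pi_gt_three
  have hR0 : 0 < R := by linarith
  have h1 : 2 / (π * R) ≤ 2 / 9 := by
    apply div_le_div_of_nonneg_left (by norm_num) (by norm_num)
    nlinarith
  have h2 : 2 / R ^ 2 ≤ 2 / 9 := by
    apply div_le_div_of_nonneg_left (by norm_num) (by norm_num)
    nlinarith
  linarith

/-- local form of `norm_tfT_le_cosh_mul`: `‖T(z,t)‖ ≤ cosh t·Mloc + cosh t·τ(R)·(M − Mloc)` (`0 ≤ t ≤ 1`). -/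
theorem norm_tfT_le_cosh_local (f : ℝ → ℂ) (hf : Continuous f) {M Mloc R : ℝ} (hM : ∀ y : ℝ, ‖tfT f y 0‖ ≤ M)
    (z : ℝ) (hR : π ≤ R) (hloc : ∀ w : ℝ, |w - z| ≤ R → ‖tfT f w 0‖ ≤ Mloc) (hMloc : Mloc ≤ M)
    {t : ℝ} (ht : 0 ≤ t) (ht1 : t ≤ 1) :
    ‖tfT f z t‖ ≤ Real.cosh t * Mloc + Real.cosh t * (2 / (π * R) + 2 / R ^ 2) * (M - Mloc) := by
  have hR0 : 0 < R := lt_of_lt_of_le Real.pi_pos hR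
  have hτ0 : 0 ≤ 2 / (π * R) + 2 / R ^ 2 := by positivity
  have hMM : 0 ≤ M - Mloc := sub_nonneg.mpr hMloc
  have hz : ‖tfT f z 0‖ ≤ Mloc := hloc z (by rw [sub_self, abs_zero]; exact hR0.le)
  rcases eq_or_lt_of_le ht with h | h
  · rw [← h, Real.cosh_zero, one_mul, one_mul]
    nlinarith [hz, mul_nonneg hτ0 hMM]
  · have hd := CoshKernel.norm_tfT_sub_le_local f hf t h hM z hR hloc hMloc
    have hst : 0 ≤ Real.sinh t / t := div_nonneg (Real.sinh_nonneg_iff.mpr h.le) h.le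
    have h2 : ‖((Real.sinh t / t : ℝ) : ℂ) * tfT f z 0‖ ≤ (Real.sinh t / t) * Mloc := by
      rw [norm_mul, Complex.norm_real, Real.norm_eq_abs, abs_of_nonneg hst]
      exact mul_le_mul_of_nonneg_left hz hst
    have hts : t * Real.sinh t ≤ Real.cosh t := by
      calc t * Real.sinh t ≤ 1 * Real.sinh t :=
            mul_le_mul_of_nonneg_right ht1 (Real.sinh_nonneg_iff.mpr h.le)
        _ ≤ Real.cosh t := by rw [one_mul]; exact (Real.sinh_lt_cosh t).le
    have hx := mul_le_mul_of_nonneg_right hts (mul_nonneg hτ0 hMM)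
    calc ‖tfT f z t‖ = ‖(tfT f z t - (Real.sinh t / t : ℝ) * tfT f z 0) + (Real.sinh t / t : ℝ) * tfT f z 0‖ := by
          rw [sub_add_cancel]
      _ ≤ ‖tfT f z t - (Real.sinh t / t : ℝ) * tfT f z 0‖ + ‖((Real.sinh t / t : ℝ) : ℂ) * tfT f z 0‖ :=
          norm_add_le _ _
      _ ≤ ((Real.cosh t - Real.sinh t / t) * Mloc + t * Real.sinh t * (2 / (π * R) + 2 / R ^ 2) * (M - Mloc))
            + (Real.sinh t / t) * Mloc := add_le_add hd h2
      _ ≤ Real.cosh t * Mloc + Real.cosh t * (2 / (π * R) + 2 / R ^ 2) * (M - Mloc) := by nlinarith [hx]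

/-- local Bernstein for `f·cosh(t·)` at `0`: `‖T₁[f cosh(t·)](0)‖ ≤ cosh t·(Mloc + 2τ(R)(M − Mloc))`, `Mloc` a bound on `|w| ≤ 2R`. -/
theorem norm_tfT₁_mul_cosh_le_local (f : ℝ → ℂ) (hf : Continuous f) {M Mloc R : ℝ} (hM : ∀ y : ℝ, ‖tfT f y 0‖ ≤ M)
    (hR : π ≤ R) (hloc : ∀ w : ℝ, |w| ≤ 2 * R → ‖tfT f w 0‖ ≤ Mloc) (hMloc : Mloc ≤ M)
    {t : ℝ} (ht : 0 ≤ t) (ht1 : t ≤ 1) :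
    ‖tfT₁ (fun u => f u * (Real.cosh (t * u) : ℂ)) 0‖
      ≤ Real.cosh t * (Mloc + 2 * (2 / (π * R) + 2 / R ^ 2) * (M - Mloc)) := by
  have hR0 : 0 < R := lt_of_lt_of_le Real.pi_pos hR
  have hτ0 : 0 ≤ 2 / (π * R) + 2 / R ^ 2 := by positivity
  have hτ1 := tau_le_one_aux hR
  have hMM : 0 ≤ M - Mloc := sub_nonneg.mpr hMloc
  have hct : 0 < Real.cosh t := Real.cosh_pos t
  have hg : Continuous (fun u : ℝ => f u * (Real.cosh (t * u) : ℂ)) := by fun_prop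
  have hMg : ∀ y : ℝ, ‖tfT (fun u => f u * (Real.cosh (t * u) : ℂ)) y 0‖ ≤ Real.cosh t * M := by
    intro y; rw [tfT_mul_cosh]; exact norm_tfT_le_cosh_mul f hf M hM ht y
  have hlocg : ∀ z : ℝ, |z - 0| ≤ R →
      ‖tfT (fun u => f u * (Real.cosh (t * u) : ℂ)) z 0‖
        ≤ Real.cosh t * Mloc + Real.cosh t * (2 / (π * R) + 2 / R ^ 2) * (M - Mloc) := by
    intro z hz
    rw [sub_zero] at hz
    rw [tfT_mul_cosh]
    refine norm_tfT_le_cosh_local f hf hM z hR (fun w hw => hloc w ?_) hMloc ht ht1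
    calc |w| = |(w - z) + z| := by rw [sub_add_cancel]
      _ ≤ |w - z| + |z| := abs_add_le _ _
      _ ≤ R + R := add_le_add hw hz
      _ = 2 * R := by ring
  have hcos0 : Real.cos 0 ≠ 0 := by rw [Real.cos_zero]; exact one_ne_zero
  have h := norm_sin_mul_add_cos_mul_le_local _ hg hMg 0 0 hlocg hcos0
  simp only [Real.sin_zero, Real.cos_zero, Complex.ofReal_zero, Complex.ofReal_one, zero_mul, one_mul,
    zero_add] at h
  have hs1 : dsTrunc 0 R ≤ 1 := dsTrunc_le_one hcos0 R
  have hs2 : 1 - dsTrunc 0 R ≤ 2 / (π * R) + 2 / R ^ 2 := one_sub_dsTrunc_le hcos0 hR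
  -- s·A + (1−s)·B = A + (1−s)(B − A) ≤ A + τ(B − A), B − A = cosh t (M − Mloc)(1 − τ) ≥ 0
  have hBA : 0 ≤ Real.cosh t * M - (Real.cosh t * Mloc + Real.cosh t * (2 / (π * R) + 2 / R ^ 2) * (M - Mloc)) := by
    have e : Real.cosh t * M - (Real.cosh t * Mloc + Real.cosh t * (2 / (π * R) + 2 / R ^ 2) * (M - Mloc))
        = Real.cosh t * (M - Mloc) * (1 - (2 / (π * R) + 2 / R ^ 2)) := by ring
    rw [e]; exact mul_nonneg (mul_nonneg hct.le hMM) (by linarith)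
  have hkey := mul_le_mul_of_nonneg_right hs2 hBA
  have hnn := mul_nonneg (mul_nonneg (mul_nonneg hct.le hτ0) hMM) hτ0
  refine h.trans ?_
  nlinarith [hkey, hnn, hBA, hs1]

end Summit.RiemannHypothesis.RiemannHypothesis.Theorems.Splittings.XWucG8.DSLine
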